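import Summits.ABC.IUTFork.Thm311RealInd1StripTwistJW
import Summits.ABC.IUTFork.Thm311RealInd1StripTwistInflationIndex
import HarnessLib

/-!
# [IUTchIII] Thm 3.11 (i) (Ind1) at `v ∈ 𝕍^non`: the R11 statements of record RE-DERIVED from the group-level Jannsen–Wingberg fact
# (`JannsenWingbergTwists`) — the `k_+`-level Kondo fact `DehnTwistTransvectionsOnUnitsAll` is no longer an input

PROOF-ONLY file (abc-iut cell, Cor. 3.12 sub-crew, seat abc-iut-c312-1 = holder of record of the typed [IUTchIII] Thm. 3.11,
gen 11; row «R12 JW-TWISTS-FROM-PRESENTATION», part c).  TAKES NO SIDE on [IUTchIII] Cor. 3.12.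

The gen-10 statements of record (`Thm311RealInd1StripTwistPlanesJW` p482234, `…TwistInflationIndex` p484887,
`…TwistMoverJWAllOdd` p480550) assumed `DehnTwistTransvectionsOnUnitsAll` — Kondo's `k_+`-LEVEL sentence «`(φ_i)_+` is the
elementary transvection» (arXiv:2512.09231, proof of Thm. 2.3 p. 10), flag (α).  `Thm311RealInd1StripTwistJW` PROVES that sentence
at every `K_v` (Hoshi–Nishio Lemma 1.3 + Kondo's computation through `θ⁻¹ ∘ φ^{ab} ∘ θ` and `log`) from the GROUP-LEVEL fact
`JannsenWingbergTwists` (Jannsen–Wingberg 1982 Thm. 2 / §5.1, NSW 7.5.14, Hoshi–Nishio Prop. 1.1: generators read through THE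
reciprocity map, + the twists `x_b ↦ x_b x_a`, `x_a ↦ x_a x_b⁻¹` of the presentation).  This file re-derives the statements of
record with `hJW : JannsenWingbergTwists` as the ONLY binder (proofs verbatim those of gen 10 with the one input swapped):
* `Real.exists_realised_planes_of_jannsenWingberg` — the `g` Jannsen–Wingberg planes REALISED in print's (Ind1) strip part
  `Real.ind1StripOf v (Real.galoisLog v)` at every `v ∣ p` odd with `[K_v : ℚ_p] ≥ 3`, `[K_v : ℚ_p] = c + 2g`, `c ≤ 2`;
* **`Real.exists_mem_ind1StripOf_galoisLog_mapsOut_closedBall_of_jannsenWingberg_odd`** / `…_analyticLogv_…` — at every `v ∣ p`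
  odd with `f(v|p)` ODD and `e(v|p) ≥ 3`, for every `k ∈ ℤ` some `χ ∈ Real.ind1StripOf v (log)` carries a point of some
  `𝔪_v^m`, `k ≤ m ≤ k + e(v|p)`, OUT of `𝔪_v^m` — print's (Ind1) strip part strictly inflates an ideal-shaped region in every window;
* `Real.exists_mem_ind1StripOf_galoisLog_image_closedBall_ne_of_jannsenWingberg_odd` — hence moves a closed ball;
* **`Real.exists_prime_le_relIndex_of_jannsenWingberg_odd`** — the same in index (log-volume) currency: `p ≤ [𝔪_v^m ⊔ χ𝔪_v^m : 𝔪_v^m]`.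
HONEST SCOPE: conditional theorems (binder `hJW`, a classical published result about `G_k` + Kondo's all-planes reading of the
Jannsen–Wingberg twist) about OUR typed objects at ONE place; what print does not pin (the `f(v|p)` even case; the position of the
planes against a given lattice) is untouched; nothing here asserts or refutes [IUTchIII] Cor. 3.12.
[claim: Mochizuki2012, status: disputed]; [cite: JannsenWingberg1982, Thm 2 p.75 and §5.1 p.96];
[cite: NeukirchSchmidtWingberg2008, Thm 7.5.14]; [cite: HoshiNishio2022OuterAutMLF, Prop 1.1 and Lemma 1.3];
[cite: Kondo2025OuterAutMLF, §2 Thm 2.1 and proof of Thm 2.3 p.10]; [cite: DupuyHilado2025, §4.7].  typed ≠ proved; a conditional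
theorem discharges nothing it binds.
-/

set_option autoImplicit false

noncomputable section

open Metric Set
open scoped Pointwise

namespace Summit.ABC.IUTFork.Thm311.Real

open NumberField IsDedekindDomain Literature.NumberTheory.NumberFields Literature.IUT.LogVolume
open Literature.NumberTheory.GaloisRepresentations Literature.NumberTheory.GaloisRepresentations.Ultrametric
open Literature.AnabelianGeometry.AbsoluteAnabelian Literature.IUT.HodgeArakelov
open Literature.IUT.HodgeArakelov.AbsTopMonoids Summit.ABC.IUTFork.Thm311.TwistLattice

variable {F : Type} [Field F] [NumberField F] (v : HeightOneSpectrum (𝓞 F))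

/-- **The Jannsen–Wingberg planes, REALISED in print's (Ind1) strip part — from the group-level fact.**  Assume
`JannsenWingbergTwists`.  At a finite place `v ∣ p` of `F` with `p` odd and `[K_v : ℚ_p] ≥ 3` there are `c ≤ 2`, `g`, with
`[K_v : ℚ_p] = c + 2g`, a family of `g` twist planes `(ya i, yb i; ca i, cb i)` of `K_v` (rescaled norm) over `ℚ_p` with the
Kronecker dualities, and `ψ i, ψ' i ∈ Real.ind1StripOf v (Real.galoisLog v)` acting on `K_v` as `x ↦ x + cb i x • ya i` and
`x ↦ x − ca i x • yb i` (gen 10's `exists_realised_planes_of_dehnTwistsAll` with its one input supplied by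
`dehnTwists_closureAt_of_jannsenWingberg`). [claim: Mochizuki2012, status: disputed]
[cite: Kondo2025OuterAutMLF, §2 Thm 2.1 and proof of Thm 2.3 p.10] [cite: JannsenWingberg1982, §5.1 p.96] -/
theorem exists_realised_planes_of_jannsenWingberg (hJW : JannsenWingbergTwists)
    (p : ℕ) [Fact p.Prime] (hv : ((p : ℕ) : 𝓞 F) ∈ v.asIdeal) (hp2 : p ≠ 2) (h3 : 3 ≤ localDeg F v) :
    ∃ (c g : ℕ) (_ : c ≤ 2) (_ : localDeg F v = c + 2 * g)
      (ca cb : Fin g → (RescaledCompletion F p v hv →ₗ[ℚ_[p]] ℚ_[p])) (ya yb : Fin g → RescaledCompletion F p v hv)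
      (ψ ψ' : Fin g → (v.adicCompletion F ≃+ v.adicCompletion F)),
      (∀ i j, ca i (ya j) = if i = j then 1 else 0) ∧ (∀ i j, cb i (yb j) = if i = j then 1 else 0) ∧
      (∀ i j, ca i (yb j) = 0) ∧ (∀ i j, cb i (ya j) = 0) ∧
      (∀ i, ψ i ∈ ind1StripOf v (galoisLog v)) ∧ (∀ i, ψ' i ∈ ind1StripOf v (galoisLog v)) ∧
      (∀ i (x : RescaledCompletion F p v hv),
        RescaledCompletion.of F p v hv (ψ i ((RescaledCompletion.of F p v hv).symm x)) = x + cb i x • ya i) ∧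
      (∀ i (x : RescaledCompletion F p v hv),
        RescaledCompletion.of F p v hv (ψ' i ((RescaledCompletion.of F p v hv).symm x)) = x - ca i x • yb i) := by
  -- `p` IS the residue characteristic of `K_v`
  obtain rfl : p = (closureAt v).residueChar := eq_residueChar_closureAt_of_natCast_mem v hv
  have hpk : ValuativeRel.valuation (v.adicCompletion F) (closureAt v).residueChar < 1 :=
    LocalField.valuation_adicCompletion_natCast_lt_one v (closureAt v).residueChar hv
  -- the canonical `ℚ_p`-structure of `K_v` (the fact's `LocalField.padicAlgebra`; = abc-iut-S7's on the rescaled completion)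
  haveI : CharZero (closureAt v).k := (closureAt v).instChar
  letI iQ : Algebra ℚ_[(closureAt v).residueChar] (closureAt v).k :=
    LocalField.padicAlgebra (closureAt v).k (closureAt v).residueChar hpk
  -- `[K_v : ℚ_p] ≥ 3` in the fact's currency
  have hlocal : localDeg F v = Module.finrank ℚ_[(closureAt v).residueChar] (closureAt v).k := by
    exact RescaledCompletion.localDeg_eq_finrank F (closureAt v).residueChar v hv
  have hfin : 3 ≤ Module.finrank ℚ_[(closureAt v).residueChar] (closureAt v).k := by
    rw [← hlocal]; exact h3
  -- the twists: ONE basis `y : Fin c ⊕ Fin g × Fin 2`, `c ≤ 2`, all `g` planes realised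
  obtain ⟨c, g, hc, y, hplanes⟩ := dehnTwists_closureAt_of_jannsenWingberg v hJW hpk hp2 hfin
  have h1 := fun i => (hplanes i).1
  have h2 := fun i => (hplanes i).2
  choose φ hφ using h1
  choose φ' hφ' using h2
  -- `[K_v : ℚ_p] = c + 2g`
  have hcard : localDeg F v = c + 2 * g := by
    rw [hlocal, Module.finrank_eq_card_basis y, Fintype.card_sum, Fintype.card_prod, Fintype.card_fin, Fintype.card_fin,
      Fintype.card_fin]
    omega
  -- the module topology of `K_v` over `ℚ_p`: linear maps are continuous
  haveI : ContinuousSMul ℚ_[(closureAt v).residueChar] (closureAt v).k :=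
    continuousSMul_of_algebraMap ℚ_[(closureAt v).residueChar] _
      (by exact LocalField.continuous_algebraMap_adicCompletionPadicAlgebra v (closureAt v).residueChar hv)
  haveI : FiniteDimensional ℚ_[(closureAt v).residueChar] (closureAt v).k :=
    Module.finite_of_finrank_pos (by omega)
  -- Kronecker dualities of the basis coordinates
  have hcoord : ∀ s t : Fin c ⊕ Fin g × Fin 2, y.coord s (y t) = if t = s then 1 else 0 := by
    intro s t
    rw [Module.Basis.coord_apply, Module.Basis.repr_self, Finsupp.single_apply]
  have haa : ∀ i j : Fin g, y.coord (Sum.inr (i, 0)) (y (Sum.inr (j, 0))) = if i = j then 1 else 0 := by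
    intro i j
    rw [hcoord]
    by_cases h : i = j
    · subst h; rw [if_pos rfl, if_pos rfl]
    · rw [if_neg h, if_neg]
      intro h'
      simp only [Sum.inr.injEq, Prod.mk.injEq] at h'
      exact h h'.1.symm
  have hbb : ∀ i j : Fin g, y.coord (Sum.inr (i, 1)) (y (Sum.inr (j, 1))) = if i = j then 1 else 0 := by
    intro i j
    rw [hcoord]
    by_cases h : i = j
    · subst h; rw [if_pos rfl, if_pos rfl]
    · rw [if_neg h, if_neg]
      intro h'
      simp only [Sum.inr.injEq, Prod.mk.injEq] at h'
      exact h h'.1.symm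
  have hab : ∀ i j : Fin g, y.coord (Sum.inr (i, 0)) (y (Sum.inr (j, 1))) = 0 := by
    intro i j
    rw [hcoord, if_neg]
    intro h'
    simp only [Sum.inr.injEq, Prod.mk.injEq] at h'
    exact absurd h'.2 (by decide)
  have hba : ∀ i j : Fin g, y.coord (Sum.inr (i, 1)) (y (Sum.inr (j, 0))) = 0 := by
    intro i j
    rw [hcoord, if_neg]
    intro h'
    simp only [Sum.inr.injEq, Prod.mk.injEq] at h'
    exact absurd h'.2 (by decide)
  -- the `2g` transvections as linear automorphisms of `K_v`
  let T : Fin g → ((closureAt v).k ≃ₗ[ℚ_[(closureAt v).residueChar]] (closureAt v).k) := fun i =>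
    LinearEquiv.ofLinear
      (LinearMap.id + (y.coord (Sum.inr (i, 1))).smulRight (y (Sum.inr (i, 0))))
      (LinearMap.id - (y.coord (Sum.inr (i, 1))).smulRight (y (Sum.inr (i, 0))))
      (by
        apply LinearMap.ext; intro x
        simp)
      (by
        apply LinearMap.ext; intro x
        simp)
  let T' : Fin g → ((closureAt v).k ≃ₗ[ℚ_[(closureAt v).residueChar]] (closureAt v).k) := fun i =>
    LinearEquiv.ofLinear
      (LinearMap.id - (y.coord (Sum.inr (i, 0))).smulRight (y (Sum.inr (i, 1))))
      (LinearMap.id + (y.coord (Sum.inr (i, 0))).smulRight (y (Sum.inr (i, 1))))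
      (by
        apply LinearMap.ext; intro x
        simp)
      (by
        apply LinearMap.ext; intro x
        simp)
  have hTapply : ∀ i x, T i x = x + y.coord (Sum.inr (i, 1)) x • y (Sum.inr (i, 0)) := fun i x => rfl
  have hT'apply : ∀ i x, T' i x = x - y.coord (Sum.inr (i, 0)) x • y (Sum.inr (i, 1)) := fun i x => rfl
  -- membership in print's (Ind1) strip part over the Galois logarithm (continuity: finite dimension over `ℚ_p`)
  have hψ : ∀ i, (T i).toAddEquiv ∈ ind1StripOf v (galoisLog v) := fun i =>
    ⟨by exact (T i).toLinearMap.continuous_of_finiteDimensional,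
      by exact (T i).symm.toLinearMap.continuous_of_finiteDimensional, φ i,
      realises_galoisLog_of_liftActsOnUnitLogAs v hpk (φ i) _ (hφ i) (T i).toAddEquiv (hTapply i)⟩
  have hψ' : ∀ i, (T' i).toAddEquiv ∈ ind1StripOf v (galoisLog v) := fun i =>
    ⟨by exact (T' i).toLinearMap.continuous_of_finiteDimensional,
      by exact (T' i).symm.toLinearMap.continuous_of_finiteDimensional, φ' i,
      realises_galoisLog_of_liftActsOnUnitLogAs v hpk (φ' i) _ (hφ' i) (T' i).toAddEquiv (hT'apply i)⟩
  -- transport of the twist data to the rescaled norm (`of` is the identity of `K_v`, `ℚ_p`-linear)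
  let e := RescaledCompletion.of F (closureAt v).residueChar v hv
  let eL : (closureAt v).k ≃ₗ[ℚ_[(closureAt v).residueChar]] RescaledCompletion F (closureAt v).residueChar v hv :=
    { e.toAddEquiv with
      map_smul' := fun c x => by
        change e (c • x) = c • e x
        rw [Algebra.smul_def, Algebra.smul_def, map_mul]
        rfl }
  have heL : ∀ x, eL x = e x := fun x => rfl
  have heLs : ∀ x, eL.symm x = e.symm x := fun x => rfl
  refine ⟨c, g, hc, hcard,
    fun i => (y.coord (Sum.inr (i, 0))).comp eL.symm.toLinearMap,
    fun i => (y.coord (Sum.inr (i, 1))).comp eL.symm.toLinearMap,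
    fun i => eL (y (Sum.inr (i, 0))), fun i => eL (y (Sum.inr (i, 1))),
    fun i => (T i).toAddEquiv, fun i => (T' i).toAddEquiv, ?_, ?_, ?_, ?_, hψ, hψ', ?_, ?_⟩
  · intro i j
    change y.coord (Sum.inr (i, 0)) (eL.symm (eL (y (Sum.inr (j, 0))))) = _
    rw [LinearEquiv.symm_apply_apply, haa]
  · intro i j
    change y.coord (Sum.inr (i, 1)) (eL.symm (eL (y (Sum.inr (j, 1))))) = _
    rw [LinearEquiv.symm_apply_apply, hbb]
  · intro i j
    change y.coord (Sum.inr (i, 0)) (eL.symm (eL (y (Sum.inr (j, 1))))) = 0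
    rw [LinearEquiv.symm_apply_apply, hab]
  · intro i j
    change y.coord (Sum.inr (i, 1)) (eL.symm (eL (y (Sum.inr (j, 0))))) = 0
    rw [LinearEquiv.symm_apply_apply, hba]
  · intro i x
    change e (T i (e.symm x)) = x + y.coord (Sum.inr (i, 1)) (eL.symm x) • eL (y (Sum.inr (i, 0)))
    rw [hTapply, map_add, RingEquiv.apply_symm_apply, ← heL, ← heLs, map_smul]
  · intro i x
    change e (T' i (e.symm x)) = x - y.coord (Sum.inr (i, 0)) (eL.symm x) • eL (y (Sum.inr (i, 1)))
    rw [hT'apply, map_sub, RingEquiv.apply_symm_apply, ← heL, ← heLs, map_smul]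

/-- **STATEMENT OF RECORD (windowed, outward) — from the group-level Jannsen–Wingberg fact.**  Assume `JannsenWingbergTwists`.
At every `v ∣ p` odd with `f(v|p)` ODD and `e(v|p) ≥ 3`, for every `k ∈ ℤ` there are `χ ∈ Real.ind1StripOf v (Real.galoisLog v)`,
`m ∈ ℤ` with `k ≤ m ≤ k + e(v|p)`, and `x ∈ 𝔪_v^m = B(0,‖ϖ‖^m)` (abc-iut-S7's rescaled norm, `ϖ` a uniformizer) with `χ(x) ∉ 𝔪_v^m`:
PRINT'S (Ind1) STRIP PART STRICTLY INFLATES AN IDEAL-SHAPED REGION IN EVERY WINDOW OF `e(v|p) + 1` CONSECUTIVE ONES.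
[claim: Mochizuki2012, status: disputed] [cite: JannsenWingberg1982, Thm 2 p.75 and §5.1 p.96]
[cite: Kondo2025OuterAutMLF, §2 proof of Thm 2.3 p.10] [cite: DupuyHilado2025, §4.7] -/
theorem exists_mem_ind1StripOf_galoisLog_mapsOut_closedBall_of_jannsenWingberg_odd (hJW : JannsenWingbergTwists)
    (p : ℕ) [Fact p.Prime] (hv : ((p : ℕ) : 𝓞 F) ∈ v.asIdeal) (hp2 : p ≠ 2)
    (hf : Odd (v.asIdeal.inertiaDeg ℤ)) (he : 3 ≤ v.asIdeal.ramificationIdx ℤ)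
    {ϖ : (RescaledCompletion F p v hv)ˣ} (hϖ : IsUniformizer ϖ) (k : ℤ) :
    ∃ χ ∈ ind1StripOf v (galoisLog v), ∃ m : ℤ, k ≤ m ∧ m ≤ k + v.asIdeal.ramificationIdx ℤ ∧
      ∃ x ∈ closedBall (0 : RescaledCompletion F p v hv) (‖(ϖ : RescaledCompletion F p v hv)‖ ^ m),
        RescaledCompletion.of F p v hv (χ ((RescaledCompletion.of F p v hv).symm x)) ∉
          closedBall (0 : RescaledCompletion F p v hv) (‖(ϖ : RescaledCompletion F p v hv)‖ ^ m) := by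
  have h3 : 3 ≤ localDeg F v := by
    rw [localDeg]; exact he.trans (Nat.le_mul_of_pos_right _ hf.pos)
  obtain ⟨c, g, hc, hcard, ca, cb, ya, yb, ψ, ψ', haa, hbb, hab, hba, hψ, hψ', hT, hT'⟩ :=
    exists_realised_planes_of_jannsenWingberg v hJW p hv hp2 h3
  have hdim : localDeg F v < v.asIdeal.ramificationIdx ℤ + 2 * Fintype.card (Fin g) := by
    rw [Fintype.card_fin]; omega
  exact exists_mem_ind1StripOf_mapsOut_closedBall_of_planes p v hv hf (galoisLog v) hϖ hdim haa hbb hab hba hψ hψ' hT hT' k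

/-- **The same over abc-iut-c312-5's ANALYTIC logarithm** (`Real.galoisLog_eq_analyticLogv`).
[claim: Mochizuki2012, status: disputed] [cite: JannsenWingberg1982, §5.1 p.96] -/
theorem exists_mem_ind1StripOf_analyticLogv_mapsOut_closedBall_of_jannsenWingberg_odd
    (hJW : JannsenWingbergTwists) (p : ℕ) [Fact p.Prime] (hv : ((p : ℕ) : 𝓞 F) ∈ v.asIdeal) (hp2 : p ≠ 2)
    (hf : Odd (v.asIdeal.inertiaDeg ℤ)) (he : 3 ≤ v.asIdeal.ramificationIdx ℤ)
    {ϖ : (RescaledCompletion F p v hv)ˣ} (hϖ : IsUniformizer ϖ) (k : ℤ) :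
    ∃ χ ∈ ind1StripOf v (analyticLogv F v), ∃ m : ℤ, k ≤ m ∧ m ≤ k + v.asIdeal.ramificationIdx ℤ ∧
      ∃ x ∈ closedBall (0 : RescaledCompletion F p v hv) (‖(ϖ : RescaledCompletion F p v hv)‖ ^ m),
        RescaledCompletion.of F p v hv (χ ((RescaledCompletion.of F p v hv).symm x)) ∉
          closedBall (0 : RescaledCompletion F p v hv) (‖(ϖ : RescaledCompletion F p v hv)‖ ^ m) := by
  rw [← galoisLog_eq_analyticLogv]
  exact exists_mem_ind1StripOf_galoisLog_mapsOut_closedBall_of_jannsenWingberg_odd v hJW p hv hp2 hf he hϖ k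

/-- **Hence print's (Ind1) strip part MOVES a closed ball** at every `v ∣ p` odd with `f(v|p)` odd, `e(v|p) ≥ 3` (a point carried
out of `𝔪_v^m` ⟹ `χ(𝔪_v^m) ≠ 𝔪_v^m`), from the group-level Jannsen–Wingberg fact.
[claim: Mochizuki2012, status: disputed] [cite: JannsenWingberg1982, §5.1 p.96] -/
theorem exists_mem_ind1StripOf_galoisLog_image_closedBall_ne_of_jannsenWingberg_odd (hJW : JannsenWingbergTwists)
    (p : ℕ) [Fact p.Prime] (hv : ((p : ℕ) : 𝓞 F) ∈ v.asIdeal) (hp2 : p ≠ 2)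
    (hf : Odd (v.asIdeal.inertiaDeg ℤ)) (he : 3 ≤ v.asIdeal.ramificationIdx ℤ)
    {ϖ : (RescaledCompletion F p v hv)ˣ} (hϖ : IsUniformizer ϖ) :
    ∃ χ ∈ ind1StripOf v (galoisLog v), ∃ m : ℤ,
      (fun x => RescaledCompletion.of F p v hv (χ ((RescaledCompletion.of F p v hv).symm x))) ''
          closedBall (0 : RescaledCompletion F p v hv) (‖(ϖ : RescaledCompletion F p v hv)‖ ^ m) ≠
        closedBall (0 : RescaledCompletion F p v hv) (‖(ϖ : RescaledCompletion F p v hv)‖ ^ m) := by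
  obtain ⟨χ, hχ, m, -, -, x, hx, hout⟩ :=
    exists_mem_ind1StripOf_galoisLog_mapsOut_closedBall_of_jannsenWingberg_odd v hJW p hv hp2 hf he hϖ 0
  refine ⟨χ, hχ, m, fun heq => hout ?_⟩
  rw [← heq]
  exact ⟨x, hx, rfl⟩

/-- **STATEMENT OF RECORD (index currency) — from the group-level Jannsen–Wingberg fact.**  Assume `JannsenWingbergTwists`.  At every
`v ∣ p` odd with `f(v|p)` ODD and `e(v|p) ≥ 3`, every window of `e(v|p)+1` consecutive ideal-shaped regions contains one, `𝔪_v^m`, such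
that the subgroup generated by `𝔪_v^m` and its image under some `χ ∈ Real.ind1StripOf v (Real.galoisLog v)` has index AT LEAST `p`
over `𝔪_v^m` — Haar reading `μ(⟨𝔪_v^m ∪ χ𝔪_v^m⟩) ≥ p · μ(𝔪_v^m)` (gen 10's proof with the input swapped).
[claim: Mochizuki2012, status: disputed] [cite: JannsenWingberg1982, §5.1 p.96] [cite: Kondo2025OuterAutMLF, §2 proof of Thm 2.3 p.10] -/
theorem exists_prime_le_relIndex_of_jannsenWingberg_odd (hJW : JannsenWingbergTwists)
    (p : ℕ) [Fact p.Prime] (hv : ((p : ℕ) : 𝓞 F) ∈ v.asIdeal) (hp2 : p ≠ 2)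
    (hf : Odd (v.asIdeal.inertiaDeg ℤ)) (he : 3 ≤ v.asIdeal.ramificationIdx ℤ)
    {ϖ : (RescaledCompletion F p v hv)ˣ} (hϖ : IsUniformizer ϖ) (k : ℤ) :
    ∃ χ ∈ ind1StripOf v (galoisLog v), ∃ m : ℤ, k ≤ m ∧ m ≤ k + v.asIdeal.ramificationIdx ℤ ∧
      p ≤ ((piBall (ϖ ^ m) : OpenAddSubgroup (RescaledCompletion F p v hv)).toAddSubgroup).relIndex
        ((piBall (ϖ ^ m) : OpenAddSubgroup (RescaledCompletion F p v hv)).toAddSubgroup ⊔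
          ((piBall (ϖ ^ m) : OpenAddSubgroup (RescaledCompletion F p v hv)).toAddSubgroup).map
            (AddEquiv.toAddMonoidHom
              (((RescaledCompletion.of F p v hv).symm.toAddEquiv.trans
                (χ.trans (RescaledCompletion.of F p v hv).toAddEquiv))))) := by
  have h3 : 3 ≤ localDeg F v := by
    rw [localDeg]; exact he.trans (Nat.le_mul_of_pos_right _ hf.pos)
  obtain ⟨c, g, hc, hcard, ca, cb, ya, yb, ψ, ψ', haa, hbb, hab, hba, hψ, hψ', hT, hT'⟩ :=
    exists_realised_planes_of_jannsenWingberg v hJW p hv hp2 h3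
  -- the invariants of `K_v` (abc-iut-S7)
  have hfK : Odd (residueDegree p (RescaledCompletion F p v hv)) := by
    rw [residueDegree_rescaledCompletion F p v hv]; exact hf
  have hfin : Module.finrank ℚ_[p] (RescaledCompletion F p v hv) = localDeg F v :=
    (RescaledCompletion.localDeg_eq_finrank F p v hv).symm
  have heK : absRamificationIdx p (RescaledCompletion F p v hv) = v.asIdeal.ramificationIdx ℤ :=
    absRamificationIdx_rescaledCompletion F p v hv
  have hdim : Module.finrank ℚ_[p] (RescaledCompletion F p v hv) <
      absRamificationIdx p (RescaledCompletion F p v hv) + 2 * Fintype.card (Fin g) := by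
    rw [heK, hfin, Fintype.card_fin]; omega
  -- the realised transvections as additive endomorphisms of `K_v` (rescaled)
  let conj : (v.adicCompletion F ≃+ v.adicCompletion F) → (RescaledCompletion F p v hv →+ RescaledCompletion F p v hv) :=
    fun χ => AddEquiv.toAddMonoidHom
      (((RescaledCompletion.of F p v hv).symm.toAddEquiv.trans (χ.trans (RescaledCompletion.of F p v hv).toAddEquiv)))
  have hconj : ∀ χ x, conj χ x = RescaledCompletion.of F p v hv (χ ((RescaledCompletion.of F p v hv).symm x)) :=
    fun _ _ => rfl
  obtain ⟨m, hkm, hmk, S, hS, hidx⟩ := exists_prime_le_relIndex_window_of_odd p hfK hdim hϖ haa hbb hab hba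
    (fun i => conj (ψ i)) (fun i => conj (ψ' i)) (fun i x => by rw [hconj, hT]) (fun i x => by rw [hconj, hT']) k
  rw [heK] at hmk
  rcases hS with ⟨i, rfl⟩ | ⟨i, rfl⟩
  · exact ⟨ψ i, hψ i, m, hkm, hmk, hidx⟩
  · exact ⟨ψ' i, hψ' i, m, hkm, hmk, hidx⟩

end Summit.ABC.IUTFork.Thm311.Real

end
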